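import Summits.CriticalPhenomena.PercolationContinuityZ3.Theorems.PercNearOneGluingNoHeavyLowerTailSahiE3ExchangeCross
import Mathlib.Order.UpperLower.Basic
import Mathlib.Tactic.Linarith
import HarnessLib
import HarnessLib.Audit

/-!
# `NoHeavyLowerTail` (crux stmt-CriticalPhenomena-4575), Sahi programme P4: the 2×2 exchange lemma — the CHAIN (join/meet) reduction and the excised join pair

Support file (cell `prim-l12`, seat P4, generation 26; `--supports stmt-CriticalPhenomena-4575`).  No named facts, no sorries;
standard axioms; def-free.

Context (HOME prim-l12-p4/FROM-prim-l12-p4-gen26-*.md; predecessors `…SahiE3ExchangeCross`, `…SahiE3ExchangeSubpairs`).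
In the exchange expression of the OR-peel on a Harris block `(B, w, V)`,
  `Φ = X_a + R(KK'V) + R(LL'V) − need(K,L') − need(L,K') + (1−v)·Y`,
the certificate `R ≥ 0` enters only through the two supplies `S₁ = K∩K'∩V`, `S₂ = L∩L'∩V`, and
`R(S₁) + R(S₂) = R(S₁∪S₂) + R(S₁∩S₂)`.  Hence ANY pair `(X₁,Y₁)` whose footprint on `V` lies in `Σ = S₁ ∪ S₂` together with
ANY pair `(X₂,Y₂)` whose footprint lies in `Δ = S₁ ∩ S₂` is an admissible 2-packing
(`chain_footprints_le_supply`), and the exchange lemma reduces to an `R`-free residual inequality for such a CHAIN of footprints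
(`exchange_of_chain`).  Generation 26 found numerically (kit census j227795: 9.7·10⁹ configuration pairs on 17 finite
distributive lattices — Boolⁿ, chain products, random posets — with log-supermodular weights incl. extreme and product ones, both
brackets; exact enumeration on Bool³ / 3×3 / chains, sampled elsewhere; HOME memo) that the two INTEGRAL 2-packings of the supply —
the chain `{Σ, Δ}` and the same-footprint pair `{S₁, S₂}` — with the best single pair per footprint certify the exchange inequality
between them in EVERY configuration tested (0 failures; the chain alone fails in 32 near-degenerate ones, the same-footprint pair
alone in 2·10⁵), whereas every
configuration-indexed cut menu fails somewhere; and that the pairs realising the chain are the UNCROSSING of the two cross pairs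
`(K,L')`, `(L,K')`: the meet pair `(K∩L, K'∩L')` (footprint `Δ`) and the join pair `(K∪L, K'∪L')` with the crossing cells
`Ξ₁ = V∩(K∖L)∩(L'∖K')`, `Ξ₂ = V∩(L∖K)∩(K'∖L')` EXCISED: for `X ⊆ K∪L`, `Y ⊆ K'∪L'`
meeting no crossing point jointly, `X∩Y∩V ⊆ Σ` (`joinPair_footprint_subset`).  On a preorder with up-sets `K, L, K', L'` the
down-closure of `Ξ₁` misses `L` and `K'` and that of `Ξ₂` misses `K` and `L'` (`crossing_lower_disjoint`), so the excised join
pair `((K∪L) ∖ D, (K'∪L') ∖ D')` with `D, D'` inside those down-closures still contains both supplies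
(`supply_subset_excisedJoin`): its footprint is exactly `Σ` once every crossing point is excised on one side.
-/

namespace Summit.CriticalPhenomena.PercolationContinuityZ3.Theorems.SahiE3ExchangeChain

open Finset SahiE3DimerPacking SahiE3ExchangeCross
open scoped BigOperators

variable {B : Type*} [DecidableEq B]

/-- **A chain of footprints fits under the supply.**  If `R ≥ 0` on `V`, the first footprint lies in the union
`K∩K' ∪ L∩L'` on `V` and the second in the intersection `K∩K'∩L∩L'` on `V`, then
`R(X₁∩Y₁∩V) + R(X₂∩Y₂∩V) ≤ R(K∩K'∩V) + R(L∩L'∩V)` (pointwise `1_Σ + 1_Δ = 1_{S₁} + 1_{S₂}`). [this work] -/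
theorem chain_footprints_le_supply (R : B → ℝ) (V K L K' L' X₁ Y₁ X₂ Y₂ : Finset B) (hR : ∀ b ∈ V, 0 ≤ R b)
    (h₁ : (X₁ ∩ Y₁) ∩ V ⊆ K ∩ K' ∪ L ∩ L') (h₂ : (X₂ ∩ Y₂) ∩ V ⊆ (K ∩ K') ∩ (L ∩ L')) :
    ∑ b ∈ (X₁ ∩ Y₁) ∩ V, R b + ∑ b ∈ (X₂ ∩ Y₂) ∩ V, R b
      ≤ ∑ b ∈ (K ∩ K') ∩ V, R b + ∑ b ∈ (L ∩ L') ∩ V, R b := by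
  simp only [sum_inter_eq_sum_ite, ← Finset.sum_add_distrib]
  refine Finset.sum_le_sum fun b hb => ?_
  have hRb := hR b hb
  by_cases hf₁ : b ∈ X₁ ∩ Y₁ <;> by_cases hf₂ : b ∈ X₂ ∩ Y₂
  · have g₂ := h₂ (Finset.mem_inter.2 ⟨hf₂, hb⟩)
    simp only [Finset.mem_inter] at g₂
    have hkk : b ∈ K ∩ K' := Finset.mem_inter.2 ⟨g₂.1.1, g₂.1.2⟩
    have hll : b ∈ L ∩ L' := Finset.mem_inter.2 ⟨g₂.2.1, g₂.2.2⟩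
    simp only [hf₁, hf₂, hkk, hll, ↓reduceIte]; linarith
  · have g₁ := h₁ (Finset.mem_inter.2 ⟨hf₁, hb⟩)
    rcases Finset.mem_union.1 g₁ with hkk | hll
    · simp only [hf₁, hf₂, hkk, ↓reduceIte, add_zero]
      by_cases hll : b ∈ L ∩ L' <;> simp only [hll, ↓reduceIte] <;> linarith
    · simp only [hf₁, hf₂, hll, ↓reduceIte, add_zero]
      by_cases hkk : b ∈ K ∩ K' <;> simp only [hkk, ↓reduceIte] <;> linarith
  · have g₂ := h₂ (Finset.mem_inter.2 ⟨hf₂, hb⟩)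
    simp only [Finset.mem_inter] at g₂
    have hkk : b ∈ K ∩ K' := Finset.mem_inter.2 ⟨g₂.1.1, g₂.1.2⟩
    have hll : b ∈ L ∩ L' := Finset.mem_inter.2 ⟨g₂.2.1, g₂.2.2⟩
    simp only [hf₁, hf₂, hkk, hll, ↓reduceIte]; linarith
  · simp only [hf₁, hf₂, ↓reduceIte, add_zero]
    by_cases hkk : b ∈ K ∩ K' <;> by_cases hll : b ∈ L ∩ L' <;> simp only [hkk, hll, ↓reduceIte] <;> linarith

/-- **The chain reduction of the exchange lemma.**  For a weight `w`, the slot `V` (`v = w(V)`), `R ≥ 0` on `V`, configuration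
sets `P, K, L, O, P', K', L', O'`, ANY bracket value `Y : ℝ`, a pair `(X₁,Y₁)` with footprint inside `Σ = (K∩K' ∪ L∩L')∩V` and
a pair `(X₂,Y₂)` with footprint inside `Δ = K∩K'∩L∩L'∩V`: the two pair inequalities and the `R`-free residual
`need(K,L') + need(L,K') − need(X₁,Y₁) − need(X₂,Y₂) ≤ X_a + (1−v)·Y` give the exchange expression `≥ 0`
(`X_a = w(PP'V) + w(OO'V) − w(P)w(O'V) − w(P')w(OV)`, `need(X,Y) = w(X)w(Y∩V) + w(Y)w(X∩V) − v·w(X)w(Y)`). [this work] -/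
theorem exchange_of_chain (w R : B → ℝ) (V K L P O K' L' P' O' X₁ Y₁ X₂ Y₂ : Finset B) (Y : ℝ)
    (hR : ∀ b ∈ V, 0 ≤ R b)
    (h₁ : (X₁ ∩ Y₁) ∩ V ⊆ K ∩ K' ∪ L ∩ L') (h₂ : (X₂ ∩ Y₂) ∩ V ⊆ (K ∩ K') ∩ (L ∩ L'))
    (hpair₁ : (∑ b ∈ X₁, w b) * (∑ b ∈ Y₁ ∩ V, w b) + (∑ b ∈ Y₁, w b) * (∑ b ∈ X₁ ∩ V, w b)
        - (∑ b ∈ V, w b) * (∑ b ∈ X₁, w b) * (∑ b ∈ Y₁, w b) ≤ ∑ b ∈ (X₁ ∩ Y₁) ∩ V, R b)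
    (hpair₂ : (∑ b ∈ X₂, w b) * (∑ b ∈ Y₂ ∩ V, w b) + (∑ b ∈ Y₂, w b) * (∑ b ∈ X₂ ∩ V, w b)
        - (∑ b ∈ V, w b) * (∑ b ∈ X₂, w b) * (∑ b ∈ Y₂, w b) ≤ ∑ b ∈ (X₂ ∩ Y₂) ∩ V, R b)
    (hres : ((∑ b ∈ K, w b) * (∑ b ∈ L' ∩ V, w b) + (∑ b ∈ L', w b) * (∑ b ∈ K ∩ V, w b)
              - (∑ b ∈ V, w b) * (∑ b ∈ K, w b) * (∑ b ∈ L', w b))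
          + ((∑ b ∈ L, w b) * (∑ b ∈ K' ∩ V, w b) + (∑ b ∈ K', w b) * (∑ b ∈ L ∩ V, w b)
              - (∑ b ∈ V, w b) * (∑ b ∈ L, w b) * (∑ b ∈ K', w b))
          - ((∑ b ∈ X₁, w b) * (∑ b ∈ Y₁ ∩ V, w b) + (∑ b ∈ Y₁, w b) * (∑ b ∈ X₁ ∩ V, w b)
              - (∑ b ∈ V, w b) * (∑ b ∈ X₁, w b) * (∑ b ∈ Y₁, w b))
          - ((∑ b ∈ X₂, w b) * (∑ b ∈ Y₂ ∩ V, w b) + (∑ b ∈ Y₂, w b) * (∑ b ∈ X₂ ∩ V, w b)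
              - (∑ b ∈ V, w b) * (∑ b ∈ X₂, w b) * (∑ b ∈ Y₂, w b))
        ≤ (∑ b ∈ (P ∩ P') ∩ V, w b) + (∑ b ∈ (O ∩ O') ∩ V, w b)
            - (∑ b ∈ P, w b) * (∑ b ∈ O' ∩ V, w b) - (∑ b ∈ P', w b) * (∑ b ∈ O ∩ V, w b)
          + (1 - ∑ b ∈ V, w b) * Y) :
    0 ≤ (∑ b ∈ (P ∩ P') ∩ V, w b) + (∑ b ∈ (O ∩ O') ∩ V, w b)
        - (∑ b ∈ P, w b) * (∑ b ∈ O' ∩ V, w b) - (∑ b ∈ P', w b) * (∑ b ∈ O ∩ V, w b)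
        + (∑ b ∈ (K ∩ K') ∩ V, R b) + (∑ b ∈ (L ∩ L') ∩ V, R b)
        - ((∑ b ∈ K, w b) * (∑ b ∈ L' ∩ V, w b) + (∑ b ∈ L', w b) * (∑ b ∈ K ∩ V, w b)
            - (∑ b ∈ V, w b) * (∑ b ∈ K, w b) * (∑ b ∈ L', w b))
        - ((∑ b ∈ L, w b) * (∑ b ∈ K' ∩ V, w b) + (∑ b ∈ K', w b) * (∑ b ∈ L ∩ V, w b)
            - (∑ b ∈ V, w b) * (∑ b ∈ L, w b) * (∑ b ∈ K', w b))
        + (1 - ∑ b ∈ V, w b) * Y := by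
  have hsup := chain_footprints_le_supply R V K L K' L' X₁ Y₁ X₂ Y₂ hR h₁ h₂
  linarith

/-- **The meet pair is admissible for `Δ`.**  `(K∩L) ∩ (K'∩L') ∩ V ⊆ (K∩K') ∩ (L∩L')` (pure bookkeeping). [this work] -/
theorem meetPair_footprint_subset (V K L K' L' : Finset B) :
    ((K ∩ L) ∩ (K' ∩ L')) ∩ V ⊆ (K ∩ K') ∩ (L ∩ L') := by
  intro b hb; simp only [Finset.mem_inter] at hb ⊢; tauto

/-- **An excised join pair is admissible for `Σ`.**  If `X ⊆ K ∪ L`, `Y ⊆ K' ∪ L'` and no crossing point of `V` lies in both —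
no point of `Ξ₁ = V∩(K∖L)∩(L'∖K')` and no point of `Ξ₂ = V∩(L∖K)∩(K'∖L')` belongs to `X ∩ Y` — then the footprint
`X ∩ Y ∩ V` lies in `Σ = K∩K' ∪ L∩L'`.  (A point of `K∪L` and of `K'∪L'` on `V` outside `KK' ∪ LL'` is a crossing point.)
[this work] -/
theorem joinPair_footprint_subset (V K L K' L' X Y : Finset B) (hX : X ⊆ K ∪ L) (hY : Y ⊆ K' ∪ L')
    (hΞ₁ : ∀ b ∈ V, b ∈ X → b ∈ Y → b ∈ K → b ∈ L' → b ∈ L ∨ b ∈ K')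
    (hΞ₂ : ∀ b ∈ V, b ∈ X → b ∈ Y → b ∈ L → b ∈ K' → b ∈ K ∨ b ∈ L') :
    (X ∩ Y) ∩ V ⊆ K ∩ K' ∪ L ∩ L' := by
  intro b hb
  simp only [Finset.mem_inter] at hb
  have hx := hX hb.1.1; have hy := hY hb.1.2
  simp only [Finset.mem_union, Finset.mem_inter] at hx hy ⊢
  rcases hx with hk | hl <;> rcases hy with hk' | hl'
  · exact Or.inl ⟨hk, hk'⟩
  · rcases hΞ₁ b hb.2 hb.1.1 hb.1.2 hk hl' with hl | hk'
    · exact Or.inr ⟨hl, hl'⟩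
    · exact Or.inl ⟨hk, hk'⟩
  · rcases hΞ₂ b hb.2 hb.1.1 hb.1.2 hl hk' with hk | hl'
    · exact Or.inl ⟨hk, hk'⟩
    · exact Or.inr ⟨hl, hl'⟩
  · exact Or.inr ⟨hl, hl'⟩

omit [DecidableEq B] in
/-- **Down-closures of the crossing cells miss the opposite sets.**  On a preorder, if `K, L, K', L'` are up-sets then a point
below a crossing point of the first kind (`ξ ∈ K∖L`, `ξ ∈ L'∖K'`) is neither in `L` nor in `K'`, and a point below a crossing point
of the second kind (`ξ ∈ L∖K`, `ξ ∈ K'∖L'`) is neither in `K` nor in `L'`. [this work] -/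
theorem crossing_lower_disjoint [Preorder B] (K L K' L' : Finset B)
    (hK : IsUpperSet (K : Set B)) (hL : IsUpperSet (L : Set B))
    (hK' : IsUpperSet (K' : Set B)) (hL' : IsUpperSet (L' : Set B)) (b ξ : B) (hle : b ≤ ξ) :
    ((ξ ∉ L → b ∉ L) ∧ (ξ ∉ K' → b ∉ K')) ∧ ((ξ ∉ K → b ∉ K) ∧ (ξ ∉ L' → b ∉ L')) := by
  refine ⟨⟨fun h hb => h ?_, fun h hb => h ?_⟩, ⟨fun h hb => h ?_, fun h hb => h ?_⟩⟩
  · exact_mod_cast hL hle (show b ∈ (L : Set B) from hb)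
  · exact_mod_cast hK' hle (show b ∈ (K' : Set B) from hb)
  · exact_mod_cast hK hle (show b ∈ (K : Set B) from hb)
  · exact_mod_cast hL' hle (show b ∈ (L' : Set B) from hb)

/-- **Both supplies survive the excision.**  On a preorder with up-sets `K, L, K', L'`: if every point of `D` lies below a
crossing point (of either kind, relative to `V`) and likewise for `D'`, then the excised join pair
`X = (K ∪ L) ∖ D`, `Y = (K' ∪ L') ∖ D'` still contains `K∩K'` and `L∩L'`; in particular
`(K∩K')∩V ∪ (L∩L')∩V ⊆ X ∩ Y ∩ V`, so together with `joinPair_footprint_subset` its footprint is exactly `Σ` when every crossing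
point is excised on one side. [this work] -/
theorem supply_subset_excisedJoin [Preorder B] (V K L K' L' D D' : Finset B)
    (hK : IsUpperSet (K : Set B)) (hL : IsUpperSet (L : Set B))
    (hK' : IsUpperSet (K' : Set B)) (hL' : IsUpperSet (L' : Set B))
    (hD : ∀ b ∈ D, ∃ ξ ∈ V, b ≤ ξ ∧ ((ξ ∈ K ∧ ξ ∉ L ∧ ξ ∈ L' ∧ ξ ∉ K') ∨ (ξ ∈ L ∧ ξ ∉ K ∧ ξ ∈ K' ∧ ξ ∉ L')))
    (hD' : ∀ b ∈ D', ∃ ξ ∈ V, b ≤ ξ ∧ ((ξ ∈ K ∧ ξ ∉ L ∧ ξ ∈ L' ∧ ξ ∉ K') ∨ (ξ ∈ L ∧ ξ ∉ K ∧ ξ ∈ K' ∧ ξ ∉ L'))) :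
    (K ∩ K') ∪ (L ∩ L') ⊆ ((K ∪ L) \ D) ∩ ((K' ∪ L') \ D') := by
  intro b hb
  simp only [Finset.mem_union, Finset.mem_inter, Finset.mem_sdiff] at hb ⊢
  -- a point of KK' or LL' is below no crossing point
  have key : ∀ ξ : B, b ≤ ξ →
      ¬ ((ξ ∈ K ∧ ξ ∉ L ∧ ξ ∈ L' ∧ ξ ∉ K') ∨ (ξ ∈ L ∧ ξ ∉ K ∧ ξ ∈ K' ∧ ξ ∉ L')) := by
    intro ξ hle hξ
    have c := crossing_lower_disjoint K L K' L' hK hL hK' hL' b ξ hle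
    rcases hb with ⟨hk, hk'⟩ | ⟨hl, hl'⟩
    · rcases hξ with ⟨_, _, _, hnk'⟩ | ⟨_, hnk, _, _⟩
      · exact c.1.2 hnk' hk'
      · exact c.2.1 hnk hk
    · rcases hξ with ⟨_, hnl, _, _⟩ | ⟨_, _, _, hnl'⟩
      · exact c.1.1 hnl hl
      · exact c.2.2 hnl' hl'
  have hbD : b ∉ D := fun h => by
    obtain ⟨ξ, -, hle, hξ⟩ := hD b h; exact key ξ hle hξ
  have hbD' : b ∉ D' := fun h => by
    obtain ⟨ξ, -, hle, hξ⟩ := hD' b h; exact key ξ hle hξ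
  rcases hb with ⟨hk, hk'⟩ | ⟨hl, hl'⟩
  · exact ⟨⟨Or.inl hk, hbD⟩, ⟨Or.inl hk', hbD'⟩⟩
  · exact ⟨⟨Or.inr hl, hbD⟩, ⟨Or.inr hl', hbD'⟩⟩

/-- **The excised join pair consists of up-sets.**  On a preorder, removing a lower set from an upper set leaves an upper set;
stated for the `Finset` coercions used above: if `J` is an up-set and `D` a down-set then `J ∖ D` is an up-set. [folklore] -/
theorem isUpperSet_sdiff_of_isLowerSet [Preorder B] (J D : Finset B)
    (hJ : IsUpperSet (J : Set B)) (hD : IsLowerSet (D : Set B)) :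
    IsUpperSet (((J \ D : Finset B)) : Set B) := by
  intro a b hab ha
  rw [Finset.coe_sdiff] at ha ⊢
  exact ⟨hJ hab ha.1, fun hb => ha.2 (hD hab hb)⟩

end Summit.CriticalPhenomena.PercolationContinuityZ3.Theorems.SahiE3ExchangeChain
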